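import Summits.Ventures.LatticeQCDFlow.Scaling.BooleanWitnessColdStartLaw

/-!
HONEST FRAMING: exact (Metropolis-corrected) sampling algorithms for lattice gauge theory; figures
of merit are autocorrelation/cost numbers at stated couplings and volumes; no continuum-physics
claim.

# BooleanStarSampleSize — THE HONEST SAMPLE SIZE FROM EVERY START WITH NOTHING OF THE VOLUME IN IT, FOR EVERY NUMBER `K` OF
# TWO-POINT REPLICAS: BURN-IN `r ≥ ⌈ρ⁻¹·log(2(1 + K(2t+h)/(2t))/ε)⌉`, RUN `N ≥ (4Var_π̃(f)/(η²ε))/(p·min{ct/(3m), h/(7K)})` ⇒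
# `P_x{|N⁻¹Σ_{s<N} f(X_{r+s}) − E_π̃ f| ≥ η} ≤ ε` (lean-2 GEN-30, ours)

Venture-side (OURS).  Cell `lqcd-flow` (pub-lqcd), unit `pub-lqcd-lean-2-g30`, 2026-08-28.  Chapter P (OPEN-MATH-chapterM item 1 on
the two-point family), file 6.  `Scaling/TwoLevelRegimeFreeSampleSize` (N20) gave the volume-free honest sample size for ONE cold level and
left `K ≥ 2` with the `log(1/π̃_min)` or `log log` burn-in of `Scaling/HalfSwapStarRecipe`.  On the two-point family the burn-in of
`Scaling/BooleanStarColdStartLaw` (P4) is volume-free for every `K`; combined with chapter N's regime-free gap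
(`Scaling/DominatedStarRegimeFreeGap`: `Gap ≥ p·min{ct/(3m), (1−t)w_0/(7K)}` under one-sided domination `p·μ_l(u) ≤ μ_0(u)`) in
Levin–Peres–Wilmer's Theorem 12.21 (typed in `Literature/Probability/MarkovChains/TimeAverageConcentration`), NEITHER the burn-in NOR the
run length involves the replica laws beyond `p` and `a`.

## What is proved

* **`boolStar_timeAverage`** — Boolean star (two-point replicas, identity maps on a hub list with multiplicities `≥ c ≥ 1`, exact hot
  redraws, `μ_k`-reversible cold kernels, `K ≥ 1`, `0 < t < 1`, `w_0 > 0`, `h = (1−t)w_0`), one-sided domination `p·μ_{κ_r+1}(u) ≤ μ_0(u)`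
  (`0 < p ≤ 1`), acceptance floor `a > 0` between unequal contents, `ρ = (th/(2t+h))·min{ac/m, 1/(K+1)}`: from EVERY start `x`, with burn-in
  `r ≥ ⌈ρ⁻¹·log((1 + K(2t+h)/(2t))/(ε/2))⌉` and run length `N ≥ 1`, `N ≥ (4Var_π̃(f)/(η²ε))·(1/(p·min{ct/(3m), h/(7K)}))`, the time average
  of any `f` over the run deviates from `E_π̃ f` by `≥ η` with probability `≤ ε`.
* **`boolWitness_timeAverage`** — the O4 witness (`μ_k = (θ,1−θ)`, `μ_0 = (pθ,1−pθ)`, idle cold replicas): the same with `a = p(1−θ)/(1−pθ)`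
  and domination constant `p` — for every `K`, hub list, `0 < θ < 1`.

Reading (no numerics implied): OPEN-MATH item 1 in its practical form (the `(ε,η)` sample size from a cold start) holds on the two-point
family for every `K`: `O((K + m/(ac))(1/t + 1/h)·log(K/ε))` steps of burn-in and `O(Var·max{m/(ct), K/h}/(p·η²ε))` steps of averaging, no
`|S|`, no `π̃_min`, no regime.  NOT CLAIMED: general `S`; anything measured.  Literature grade (cell rule): OWN COMPOSITION on P4, N2, N3
and the typed [LevinPeres2017, Thm 12.21]; nothing new cited as a fact; no new bib keys.
-/

noncomputable section

open Finset Function Matrix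
open Literature.Probability.MarkovChains

namespace Summit.Ventures.LatticeQCDFlow.Scaling

variable {K m : ℕ} {μ : Fin (K + 1) → Bool → ℝ} {M : Fin (K + 1) → Bool → Bool → ℝ} {w : Fin (K + 1) → ℝ} {t p θ : ℝ}

section SampleSize
variable (κ : Fin m → Fin K)

/-- **THE VOLUME-FREE HONEST SAMPLE SIZE FROM EVERY START, `K` TWO-POINT REPLICAS:** burn-in
`r ≥ ⌈ρ⁻¹·log((1 + K(2t+h)/(2t))/(ε/2))⌉` (`ρ = (th/(2t+h))·min{ac/m, 1/(K+1)}`), run `N ≥ 1` with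
`N ≥ (4Var_π̃(f)/(η²ε))/(p·min{ct/(3m), h/(7K)})` ⇒ `P_x{|N⁻¹Σ_{s<N} f(X_{r+s}) − E_π̃ f| ≥ η} ≤ ε`. [ours] -/
theorem boolStar_timeAverage (hK : 1 ≤ K) (hm : 1 ≤ m) (ht0 : 0 < t) (ht1 : t < 1) (hw0 : ∀ k, 0 ≤ w k) (hw00 : 0 < w 0)
    (hw1 : ∑ k, w k = 1) (hμ : ∀ k x, 0 < μ k x) (hμ1 : ∀ k, ∑ u, μ k u = 1) (hM : ∀ k, IsRowStochastic (M k))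
    (hMrev : ∀ k, DetailedBalance (μ k) (M k)) (hM0 : ∀ u v, M 0 u v = μ 0 v) (hp0 : 0 < p) (hp1 : p ≤ 1)
    (hdom : ∀ (r : Fin m) (u : Bool), p * μ (κ r).succ u ≤ μ 0 u) {a : ℝ} (ha0 : 0 < a)
    (ha : ∀ (r : Fin m) (z : Fin (K + 1) → Bool), z 0 ≠ z (κ r).succ →
      a ≤ min 1 (tensorFun μ (edgeFlowSwap (Equiv.refl Bool) 0 (κ r).succ z) / tensorFun μ z))
    {c : ℕ} (hc1 : 1 ≤ c) (hc : ∀ p' : Fin K, c ≤ (univ.filter (fun r : Fin m => κ r = p')).card)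
    (f : (Fin (K + 1) → Bool) → ℝ) {ε η : ℝ} (hε : 0 < ε) (hη : 0 < η) {r N : ℕ}
    (hr : ⌈1 / (t * ((1 - t) * w 0) / (2 * t + (1 - t) * w 0) * min (a * c / m) (1 / (K + 1)))
          * Real.log ((1 + K * (2 * t + (1 - t) * w 0) / (2 * t)) / (ε / 2))⌉₊ ≤ r) (hN : 0 < N)
    (hNvar : 4 * lawVariance (tensorFun μ) f / (η ^ 2 * ε) * (1 / (p * min (c * t / (3 * m)) ((1 - t) * w 0 / (7 * K)))) ≤ N)
    (x : Fin (K + 1) → Bool) :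
    pathSum (fun y z : Fin (K + 1) → Bool =>
        t * ptGraphSwap μ (fun r : Fin m => (((0 : Fin (K + 1)), (κ r).succ) : Fin (K + 1) × Fin (K + 1)))
              (fun _ : Fin m => Equiv.refl Bool) y z + (1 - t) * prodKernel w M y z) (N + r) x (fun ω =>
        if η ≤ |(∑ s : Fin N, f ((Matrix.vecCons x ω : Fin (N + r + 1) → (Fin (K + 1) → Bool))
              ⟨(s : ℕ) + r, by have := s.isLt; omega⟩)) / N - lawMean (tensorFun μ) f|
          then (1 : ℝ) else 0) ≤ ε := by
  have hmpos : (0 : ℝ) < m := Nat.cast_pos.mpr (by omega)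
  have hKpos : (0 : ℝ) < K := Nat.cast_pos.mpr (by omega)
  have hP := weightedScheme_isRowStochastic (t := t) (w := w)
    (ptGraphSwap_isRowStochastic (e := fun r : Fin m => (((0 : Fin (K + 1)), (κ r).succ) : Fin (K + 1) × Fin (K + 1)))
      (φ := fun _ : Fin m => Equiv.refl Bool) hμ) hM hw0 hw1 ht0.le ht1.le
  have hDB := weightedScheme_detailedBalance (w := w)
    (ptGraphSwap_detailedBalance (e := fun r : Fin m => (((0 : Fin (K + 1)), (κ r).succ) : Fin (K + 1) × Fin (K + 1)))
      (φ := fun _ : Fin m => Equiv.refl Bool) hμ) hMrev t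
  have hirr := dominatedStar_isIrreducible_regimeFree κ (fun _ : Fin m => Equiv.refl Bool) ht0 ht1 hw0 hw00 hw1 hμ hM hM0 hc1 hc
  have hε2 : 0 < ε / 2 := by linarith
  -- the volume-free burn-in of P4: `d(r₀) ≤ ε/2` at `r₀ = ⌈ρ⁻¹ log(2C/ε)⌉`, and `t_mix(ε/2) ≤ r₀ ≤ r`
  set r₀ : ℕ := ⌈1 / (t * ((1 - t) * w 0) / (2 * t + (1 - t) * w 0) * min (a * c / m) (1 / (K + 1)))
      * Real.log ((1 + K * (2 * t + (1 - t) * w 0) / (2 * t)) / (ε / 2))⌉₊ with hr₀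
  have hmix := boolStar_mixingTime_le κ hm ht0 ht1 hw0 hw00 hw1 hμ hμ1 hM hMrev hM0 ha0 hc1 hc ha hε2
  have ht₀ : worstTvDist (fun y z : Fin (K + 1) → Bool =>
      t * ptGraphSwap μ (fun r : Fin m => (((0 : Fin (K + 1)), (κ r).succ) : Fin (K + 1) × Fin (K + 1)))
            (fun _ : Fin m => Equiv.refl Bool) y z + (1 - t) * prodKernel w M y z) (tensorFun μ) r₀ ≤ ε / 2 := by
    -- as in `boolStar_mixingTime_le`: the tuned law at `r₀`
    have hh0 : 0 < (1 - t) * w 0 := mul_pos (by linarith) hw00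
    set ρ := t * ((1 - t) * w 0) / (2 * t + (1 - t) * w 0) * min (a * c / m) (1 / (K + 1)) with hρ
    have hρ0 : 0 < ρ := by
      have : 0 < min (a * c / (m : ℝ)) (1 / ((K : ℝ) + 1)) := lt_min (by positivity) (by positivity)
      positivity
    have hρ1 : ρ ≤ 1 := by
      have h1 : t * ((1 - t) * w 0) / (2 * t + (1 - t) * w 0) ≤ 1 := by
        rw [div_le_one (by positivity)]; nlinarith [mul_pos ht0 hh0]
      have h2 : min (a * c / (m : ℝ)) (1 / ((K : ℝ) + 1)) ≤ 1 := (min_le_right _ _).trans (by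
        rw [div_le_one (by positivity)]; linarith)
      have h3 : 0 ≤ min (a * c / (m : ℝ)) (1 / ((K : ℝ) + 1)) := le_min (by positivity) (by positivity)
      calc ρ ≤ 1 * 1 := mul_le_mul h1 h2 h3 zero_le_one
        _ = 1 := one_mul 1
    exact (boolStar_worstTvDist_le_tuned κ hm ht0 ht1 hw0 hw00 hw1 hμ hμ1 hM hMrev hM0 ha0.le hc ha r₀).trans
      (geom_le_of_ge_log hρ0 hρ1 (by positivity) hε2 (Nat.le_ceil _))
  -- the run length through `Gap ≥ p·min{ct/(3m), (1−t)w_0/(7K)}`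
  have hgap := dominatedStar_spectralGap_ge_regimeFree κ (fun _ : Fin m => Equiv.refl Bool) hK hm ht0 ht1 hw0 hw00 hw1 hμ hμ1 hM
    hMrev hM0 hp0 hp1 hdom hc1 hc
  have hGpos : 0 < p * min (c * t / (3 * m)) ((1 - t) * w 0 / (7 * K)) := mul_pos hp0 (lt_min (by positivity) (by
    have : 0 < 1 - t := by linarith
    positivity))
  have hγinv : (spectralGap (tensorFun μ) (fun y z : Fin (K + 1) → Bool =>
      t * ptGraphSwap μ (fun r : Fin m => (((0 : Fin (K + 1)), (κ r).succ) : Fin (K + 1) × Fin (K + 1)))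
            (fun _ : Fin m => Equiv.refl Bool) y z + (1 - t) * prodKernel w M y z))⁻¹
      ≤ 1 / (p * min (c * t / (3 * m)) ((1 - t) * w 0 / (7 * K))) := by
    rw [← one_div]; exact one_div_le_one_div_of_le hGpos hgap
  have hV : 0 ≤ 4 * lawVariance (tensorFun μ) f / (η ^ 2 * ε) :=
    div_nonneg (mul_nonneg (by norm_num) (lawVariance_nonneg (fun z => (tensorFun_pos hμ z).le) f)) (by positivity)
  exact LevinPeres2017_thm_12_21 (fun z => tensorFun_pos hμ z) (sum_tensorFun_eq_one _ hμ1) hP hDB hirr f hε hη ht₀ (hmix.trans hr) hN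
    ((mul_le_mul_of_nonneg_left hγinv hV).trans hNvar) x

/-- **THE VOLUME-FREE HONEST SAMPLE SIZE ON THE WITNESS, EVERY `K`:** `K` cold replicas `(θ,1−θ)`, hot `(pθ,1−pθ)`, identity maps, exact hot
redraws, idle cold replicas, hub multiplicities between `c ≥ 1` and anything: burn-in
`r ≥ ⌈ρ⁻¹·log((1 + K(2t+h)/(2t))/(ε/2))⌉` with `ρ = (th/(2t+h))·min{p(1−θ)c/((1−pθ)m), 1/(K+1)}`, run `N ≥ 1` with
`N ≥ (4Var_π̃(f)/(η²ε))/(p·min{ct/(3m), h/(7K)})` ⇒ `P_x{|N⁻¹Σ_{s<N} f(X_{r+s}) − E_π̃ f| ≥ η} ≤ ε` — no `log(1/θ)` anywhere. [ours] -/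
theorem boolWitness_timeAverage (hK : 1 ≤ K) (hm : 1 ≤ m) (ht0 : 0 < t) (ht1 : t < 1) (hw0 : ∀ k, 0 ≤ w k) (hw00 : 0 < w 0)
    (hw1 : ∑ k, w k = 1) (hp0 : 0 < p) (hp1 : p ≤ 1) (hθ0 : 0 < θ) (hθ1 : θ < 1)
    {c : ℕ} (hc1 : 1 ≤ c) (hc : ∀ p' : Fin K, c ≤ (univ.filter (fun r : Fin m => κ r = p')).card)
    (f : (Fin (K + 1) → Bool) → ℝ) {ε η : ℝ} (hε : 0 < ε) (hη : 0 < η) {r N : ℕ}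
    (hr : ⌈1 / (t * ((1 - t) * w 0) / (2 * t + (1 - t) * w 0) * min (p * (1 - θ) / (1 - p * θ) * c / m) (1 / (K + 1)))
          * Real.log ((1 + K * (2 * t + (1 - t) * w 0) / (2 * t)) / (ε / 2))⌉₊ ≤ r) (hN : 0 < N)
    (hNvar : 4 * lawVariance (tensorFun (fun (k : Fin (K + 1)) (b : Bool) =>
          if k = 0 then (if b then p * θ else 1 - p * θ) else (if b then θ else 1 - θ))) f / (η ^ 2 * ε)
        * (1 / (p * min (c * t / (3 * m)) ((1 - t) * w 0 / (7 * K)))) ≤ N)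
    (x : Fin (K + 1) → Bool) :
    pathSum (fun y z : Fin (K + 1) → Bool =>
        t * ptGraphSwap (fun (k : Fin (K + 1)) (b : Bool) =>
              if k = 0 then (if b then p * θ else 1 - p * θ) else (if b then θ else 1 - θ))
            (fun r : Fin m => (((0 : Fin (K + 1)), (κ r).succ) : Fin (K + 1) × Fin (K + 1)))
            (fun _ : Fin m => Equiv.refl Bool) y z
          + (1 - t) * prodKernel w (fun (k : Fin (K + 1)) (u v : Bool) =>
              if k = 0 then (if v then p * θ else 1 - p * θ) else (if u = v then (1 : ℝ) else 0)) y z) (N + r) x (fun ω =>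
        if η ≤ |(∑ s : Fin N, f ((Matrix.vecCons x ω : Fin (N + r + 1) → (Fin (K + 1) → Bool))
              ⟨(s : ℕ) + r, by have := s.isLt; omega⟩)) / N
            - lawMean (tensorFun (fun (k : Fin (K + 1)) (b : Bool) =>
                if k = 0 then (if b then p * θ else 1 - p * θ) else (if b then θ else 1 - θ))) f|
          then (1 : ℝ) else 0) ≤ ε := by
  have hpθ1 : p * θ < 1 := by nlinarith
  have hμ : ∀ (k : Fin (K + 1)) (x : Bool), 0 < (fun (k : Fin (K + 1)) (b : Bool) =>
      if k = 0 then (if b then p * θ else 1 - p * θ) else (if b then θ else 1 - θ)) k x := by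
    intro k x
    by_cases hk : k = 0
    · simp only [hk, if_true]; split_ifs; exacts [mul_pos hp0 hθ0, by linarith]
    · simp only [hk, if_false]; split_ifs; exacts [hθ0, by linarith]
  have hμ1 : ∀ k : Fin (K + 1), ∑ u, (fun (k : Fin (K + 1)) (b : Bool) =>
      if k = 0 then (if b then p * θ else 1 - p * θ) else (if b then θ else 1 - θ)) k u = 1 := by
    intro k
    by_cases hk : k = 0
    · simp only [hk, if_true]; exact sum_bool_law _
    · simp only [hk, if_false]; exact sum_bool_law _
  have hM := fun k : Fin (K + 1) => boolWitness_rowStochastic (K := K) hp0.le hp1 hθ0.le hθ1.le k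
  have hMrev := fun k : Fin (K + 1) => boolWitness_detailedBalance (K := K) (p := p) (θ := θ) k
  have hM0 : ∀ u v : Bool, (fun (k : Fin (K + 1)) (u v : Bool) =>
      if k = 0 then (if v then p * θ else 1 - p * θ) else (if u = v then (1 : ℝ) else 0)) 0 u v
      = (fun (k : Fin (K + 1)) (b : Bool) => if k = 0 then (if b then p * θ else 1 - p * θ) else (if b then θ else 1 - θ)) 0 v := by
    intro u v; simp only [if_true]
  have hdom := boolWitness_oneSided κ (K := K) (θ := θ) hp1
  simp only [Equiv.refl_apply] at hdom
  have ha0 : 0 < p * (1 - θ) / (1 - p * θ) := div_pos (mul_pos hp0 (by linarith)) (by linarith)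
  exact boolStar_timeAverage κ hK hm ht0 ht1 hw0 hw00 hw1 hμ hμ1 hM hMrev hM0 hp0 hp1 hdom ha0 (boolWitness_accept_ge κ hp0 hp1 hθ0 hθ1)
    hc1 hc f hε hη hr hN hNvar x

end SampleSize

end Summit.Ventures.LatticeQCDFlow.Scaling

end
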